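import Summits.BirchSwinnertonDyer.BirchSwinnertonDyer.Theorems.PrintCFramBottomClassIndexLawFiveLeHerbrandOddClassGroupQuotient
import HarnessLib

/-!
# Route `PrintCFram`, crux C2 `BottomClassIndexLawFiveLe` (stmt-BirchSwinnertonDyer-20372), line
# `eisenstein-resource-bdp-line` v10, Stub H `stub_bottomResidualSelmer_trivial_of_bernoulliPair`, typing item T5:
# THE ODD CLASS-GROUP TERMS FROM A CHARACTER OF `Γ_ℚ` — descent `Γ_ℚ → Gal(L/ℚ)` of the Dirichlet avatar
# (cell `bsd-print-cfram`, seat `bsd-line-cfram-p1-w6` g0; helper `--supports` 20372; 0 facts, 0 defs)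

HONEST FRAMING. Nothing about BSD is proved here; no summit statement is proved by this seat. The T1 end state of the line
(`HerbrandLineCharacters…Dirichlet`, LEAD g8) delivers the characters of the line as characters of ABSOLUTE Galois groups
composed with the cyclotomic character: `θ = b ∘ χ_m ∘ res`, Teichmüller lift `ψ₁ = Teich ∘ b` a `ℚ_p`-valued Dirichlet
character mod `m`. The Mazur–Wiles fact (`ImaginaryAbelianFieldOddChiClassNumber.lean`) wants a character `ψ` of the FINITE group
`Gal(L/ℚ)` with `ψ(τ̄) = χ(χ_f(τ))`. This file supplies the descent: a homomorphism `φ : Γ_ℚ → A` which kills the image of `Γ_L`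
(`absGaloisRestrict ℚ L`) factors uniquely through `τ ↦ τ̄ = absGaloisQuot ℚ L τ` (`exists_factor_absGaloisQuot`,
`factor_absGaloisQuot_unique`; kernel of `absGaloisQuot` = image of `Γ_L`, tree `absGaloisQuot_eq_one_iff`, and Mathlib's
`MonoidHom.liftOfSurjective`), and restates the two consumer forms of the odd class-group terms of (M1) — TORSION
(`classGroup_torsion_eigen_eq_zero_of_absGalois`) and QUOTIENT (`classGroup_eigen_mod_mem_smul_of_absGalois`) — with ALL
Galois-side hypotheses on `Γ_ℚ`: `φ : Γ_ℚ →* ℤ_pˣ` trivial on `Γ_L`, `φ(τ) = χ(χ_f(τ))` in `ℚ_p`, and the eigen-condition on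
`x ∈ Cl(L)` written at `τ̄` for `τ ∈ Γ_ℚ` with eigenvalue `φ(τ) mod p`. Under Mazur–Wiles and `‖B_{1,χ⁻¹}‖_p = 1` such `x` vanish
(resp. lie in `p·Cl(L)`).

THEOREMS ONLY; no definition, no named fact, no `sorry`; imports no `Theses` module. The Mazur–Wiles fact is a HYPOTHESIS.
References: [MazurWiles1984] Thm. 2 (p. 216) via [Solomon1990] p. 468; [NeukirchANT1999] Ch. IV §1 (`Γ_F → Gal(M/F)`).
-/

set_option autoImplicit false
-- `…BirchSwinnertonDyer.BirchSwinnertonDyer.Theorems…` is the problem's mandated namespace (D-0017).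
set_option linter.dupNamespace false

noncomputable section

open NumberField Field
open Literature.RepresentationTheory.FiniteGroups Literature.NumberTheory.NumberFields
open Literature.NumberTheory.GaloisRepresentations Literature.NumberTheory.EllipticCurves

namespace Summit.BirchSwinnertonDyer.BirchSwinnertonDyer.Theorems.PrintCFram.HerbrandOddClassGroup

/-! ## §1 Descent of homomorphisms along `Γ_ℚ → Gal(L/ℚ)` -/

section Descent

variable (F L : Type*) [Field F] [Field L] [Algebra F L] [Normal F L] {A : Type*} [Group A]

/-- The kernel of `τ ↦ τ̄ : Γ_F → Gal(L/F)` is contained in the kernel of every homomorphism `φ : Γ_F → A`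
that kills the image of `Γ_L` (`ker(τ ↦ τ̄) = res(Γ_L)`, tree `absGaloisQuot_eq_one_iff`).
[cite: NeukirchANT1999, Ch. IV §1 (the restriction Γ_F → Gal(M/F) and its kernel Γ_M)] -/
theorem ker_absGaloisQuot_le_ker (φ : absoluteGaloisGroup F →* A)
    (hφ : ∀ σ : absoluteGaloisGroup L, φ (absGaloisRestrict F L σ) = 1) :
    (absGaloisQuot F L).ker ≤ φ.ker := by
  intro τ hτ
  rw [MonoidHom.mem_ker] at hτ ⊢
  obtain ⟨σ, rfl⟩ := (absGaloisQuot_eq_one_iff F L τ).mp hτ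
  exact hφ σ

/-- **Descent `Γ_F → Gal(L/F)`.** A homomorphism `φ : Γ_F → A` which is trivial on the image of `Γ_L` factors
through `Gal(L/F)`: there is `ψ : Gal(L/F) → A` with `ψ(τ̄) = φ(τ)` for all `τ ∈ Γ_F` (Mathlib `MonoidHom.liftOfSurjective`
for the surjection `absGaloisQuot F L`). [cite: NeukirchANT1999, Ch. IV §1] -/
theorem exists_factor_absGaloisQuot (φ : absoluteGaloisGroup F →* A)
    (hφ : ∀ σ : absoluteGaloisGroup L, φ (absGaloisRestrict F L σ) = 1) :
    ∃ ψ : (L ≃ₐ[F] L) →* A, ∀ τ : absoluteGaloisGroup F, ψ (absGaloisQuot F L τ) = φ τ := by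
  refine ⟨(absGaloisQuot F L).liftOfSurjective (absGaloisQuot_surjective F L)
    ⟨φ, ker_absGaloisQuot_le_ker F L φ hφ⟩, fun τ => ?_⟩
  exact (absGaloisQuot F L).liftOfRightInverse_comp_apply _ _ _ τ

/-- Uniqueness of the descended homomorphism (`τ ↦ τ̄` is onto, tree `absGaloisQuot_surjective`).
[cite: NeukirchANT1999, Ch. IV §1] -/
theorem factor_absGaloisQuot_unique {φ : absoluteGaloisGroup F →* A} {ψ ψ' : (L ≃ₐ[F] L) →* A}
    (hψ : ∀ τ : absoluteGaloisGroup F, ψ (absGaloisQuot F L τ) = φ τ)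
    (hψ' : ∀ τ : absoluteGaloisGroup F, ψ' (absGaloisQuot F L τ) = φ τ) : ψ = ψ' := by
  refine MonoidHom.ext fun σ => ?_
  obtain ⟨τ, rfl⟩ := absGaloisQuot_surjective F L σ
  rw [hψ τ, hψ' τ]

end Descent

/-! ## §2 The odd class-group terms with all Galois data on `Γ_ℚ` -/

section AbsGalois

variable {p : ℕ} [Fact p.Prime] {L : Type} [Field L] [NumberField L] [IsAbelianGalois ℚ L]

/-- **TORSION form from `Γ_ℚ`-data.** `p` odd; `L/ℚ` abelian with `p ∤ [L : ℚ]`; `χ` a primitive odd `ℚ_p`-valued Dirichlet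
character of conductor `f`, not the Teichmüller character; `φ : Γ_ℚ → ℤ_pˣ` trivial on `Γ_L` with `φ(τ) = χ(χ_f(τ))` for all `τ`
(the Teichmüller-lifted Dirichlet avatar, as delivered by the line's T1); ASSUME Mazur–Wiles and `‖B_{1,χ⁻¹}‖_p = 1`. Then every
`x ∈ Cl(L)` with `p • x = 0` and `τ̄ · x = (φ(τ) mod p) x` for all `τ ∈ Γ_ℚ` is `0`.
[cite: MazurWiles1984, Thm. 2 (p. 216) — via Solomon1990, §I p. 468; Lang1990, Ch. 1 §3 Cor. 3] -/
theorem classGroup_torsion_eigen_eq_zero_of_absGalois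
    (hMW : MazurWiles1984.thm2_card_oddChiClassGroup_eq_bernoulli) (hp2 : p ≠ 2)
    (hpL : ¬ p ∣ Module.finrank ℚ L)
    {f : ℕ} [NeZero f] {χ : DirichletCharacter ℚ_[p] f} (hprim : χ.IsPrimitive) (hodd : χ.Odd)
    (hχω : ¬ ∀ a : ℤ, ¬ ((p : ℤ) ∣ a) → ‖χ (a : ZMod f) - (a : ℚ_[p])‖ < 1)
    (φ : absoluteGaloisGroup ℚ →* ℤ_[p]ˣ)
    (hφL : ∀ σ : absoluteGaloisGroup L, φ (absGaloisRestrict ℚ L σ) = 1)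
    (hφχ : ∀ τ : absoluteGaloisGroup ℚ,
      (((φ τ : ℤ_[p]ˣ) : ℤ_[p]) : ℚ_[p]) = χ ((modNCyclotomicCharacter ℚ f τ : (ZMod f)ˣ) : ZMod f))
    (hB : ‖KrizLi2019.bernoulliOnePrim χ⁻¹‖ = 1)
    {x : Additive (ClassGroup (𝓞 L))} (hpx : p • x = 0)
    (hx : ∀ τ : absoluteGaloisGroup ℚ, classGroupRep ℚ L (absGaloisQuot ℚ L τ) x =
      ((PadicInt.toZMod ((φ τ : ℤ_[p]ˣ) : ℤ_[p])).val : ℤ) • x) :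
    x = 0 := by
  obtain ⟨ψ, hψ⟩ := exists_factor_absGaloisQuot ℚ L φ hφL
  -- the reduction `θ̄ = ψ mod p`
  let θ : (L ≃ₐ[ℚ] L) →* (ZMod p)ˣ := (Units.map (PadicInt.toZMod (p := p)).toMonoidHom).comp ψ
  have hθ : ∀ σ : L ≃ₐ[ℚ] L, PadicInt.toZMod ((ψ σ : ℤ_[p]ˣ) : ℤ_[p]) = ((θ σ : (ZMod p)ˣ) : ZMod p) :=
    fun σ => rfl
  have hψχ : ∀ τ : absoluteGaloisGroup ℚ,
      (((ψ (absGaloisQuot ℚ L τ) : ℤ_[p]ˣ) : ℤ_[p]) : ℚ_[p]) =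
        χ ((modNCyclotomicCharacter ℚ f τ : (ZMod f)ˣ) : ZMod f) := fun τ => by rw [hψ τ]; exact hφχ τ
  refine classGroup_torsion_eigen_eq_zero hMW hp2 hpL hprim hodd hχω hψχ hB θ hθ hpx fun σ => ?_
  obtain ⟨τ, rfl⟩ := absGaloisQuot_surjective ℚ L σ
  rw [hx τ, ← hθ, hψ τ]

/-- **QUOTIENT form from `Γ_ℚ`-data.** Same setting; every `x ∈ Cl(L)` with `τ̄ · x = (φ(τ) mod p) x + p w_τ` for all
`τ ∈ Γ_ℚ` lies in `p · Cl(L)`.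
[cite: MazurWiles1984, Thm. 2 (p. 216) — via Solomon1990, §I p. 468; Lang1990, Ch. 1 §3 Cor. 3] -/
theorem classGroup_eigen_mod_mem_smul_of_absGalois
    (hMW : MazurWiles1984.thm2_card_oddChiClassGroup_eq_bernoulli) (hp2 : p ≠ 2)
    (hpL : ¬ p ∣ Module.finrank ℚ L)
    {f : ℕ} [NeZero f] {χ : DirichletCharacter ℚ_[p] f} (hprim : χ.IsPrimitive) (hodd : χ.Odd)
    (hχω : ¬ ∀ a : ℤ, ¬ ((p : ℤ) ∣ a) → ‖χ (a : ZMod f) - (a : ℚ_[p])‖ < 1)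
    (φ : absoluteGaloisGroup ℚ →* ℤ_[p]ˣ)
    (hφL : ∀ σ : absoluteGaloisGroup L, φ (absGaloisRestrict ℚ L σ) = 1)
    (hφχ : ∀ τ : absoluteGaloisGroup ℚ,
      (((φ τ : ℤ_[p]ˣ) : ℤ_[p]) : ℚ_[p]) = χ ((modNCyclotomicCharacter ℚ f τ : (ZMod f)ˣ) : ZMod f))
    (hB : ‖KrizLi2019.bernoulliOnePrim χ⁻¹‖ = 1)
    {x : Additive (ClassGroup (𝓞 L))}
    (hx : ∀ τ : absoluteGaloisGroup ℚ, ∃ w : Additive (ClassGroup (𝓞 L)),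
      classGroupRep ℚ L (absGaloisQuot ℚ L τ) x =
        ((PadicInt.toZMod ((φ τ : ℤ_[p]ˣ) : ℤ_[p])).val : ℤ) • x + (p : ℤ) • w) :
    ∃ y : Additive (ClassGroup (𝓞 L)), x = (p : ℤ) • y := by
  obtain ⟨ψ, hψ⟩ := exists_factor_absGaloisQuot ℚ L φ hφL
  let θ : (L ≃ₐ[ℚ] L) →* (ZMod p)ˣ := (Units.map (PadicInt.toZMod (p := p)).toMonoidHom).comp ψ
  have hθ : ∀ σ : L ≃ₐ[ℚ] L, PadicInt.toZMod ((ψ σ : ℤ_[p]ˣ) : ℤ_[p]) = ((θ σ : (ZMod p)ˣ) : ZMod p) :=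
    fun σ => rfl
  have hψχ : ∀ τ : absoluteGaloisGroup ℚ,
      (((ψ (absGaloisQuot ℚ L τ) : ℤ_[p]ˣ) : ℤ_[p]) : ℚ_[p]) =
        χ ((modNCyclotomicCharacter ℚ f τ : (ZMod f)ˣ) : ZMod f) := fun τ => by rw [hψ τ]; exact hφχ τ
  refine classGroup_eigen_mod_mem_smul hMW hp2 hpL hprim hodd hχω hψχ hB θ hθ fun σ => ?_
  obtain ⟨τ, rfl⟩ := absGaloisQuot_surjective ℚ L σ
  obtain ⟨w, hw⟩ := hx τ
  exact ⟨w, by rw [hw, ← hθ, hψ τ]⟩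

end AbsGalois

end Summit.BirchSwinnertonDyer.BirchSwinnertonDyer.Theorems.PrintCFram.HerbrandOddClassGroup

end
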